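import Summits.QuantumFields.QCD.Theses.GapBuysCauchyRate
import Literature.MathematicalPhysics.QuantumFieldTheory.GaugeCovariantBlockMap
import Literature.MathematicalPhysics.QuantumFieldTheory.QCDTorusTranslation
import Literature.MathematicalPhysics.QuantumFieldTheory.QCDPhaseQuenchedReweighting

/-!
# Stub `stub_glueTwoPointReal` of line `birth` for crux `GapBuysCauchyRate.LadderCauchyRate`
(item stmt-QuantumFields-17307, route route-QuantumFields-GapBuysCauchyRate, sub-problem QCD)

What is proved: for every flavour number `N_f`, every regularisation `reg`, all renormalised quark
masses `m`, all species renormalisations `(z, shift)`, every step `k` and all real test functions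
`g, f`, the BARE lattice one-point function `S₁^{glue}(f) = ⟨Φ_k^{glue}(f)⟩` and two-point function
`S₂^{glue,glue}(g ⊗ f) = ⟨Φ_k^{glue}(g) Φ_k^{glue}(f)⟩` of the scheme `reg.scheme m z shift` are REAL
(imaginary part `0`).  In fact this holds for every `QCDScheme` (`onePoint_glue_im`,
`twoPoint_glue_im`).

How.  The `glue` insertion `insertion U glue x` is the real Wilson action density cast into the
Grassmann algebra, so the smeared field `Φ_k^{glue}(f) = Σ_x z a⁴ f(a x) (O(x) − shift)` is
`algebraMap` of a real number `r_f(U)` (`smearedInsertion_glue`), and so is the product of two of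
them.  The Berezin integral of `(c · 1) e^{−ψ̄Dψ}` is `ε · c · det D` (`fermiIntegral_fermiBoltzmann`,
`ε = (−1)^{n(n−1)/2+n}` the orientation sign of the `n` quark variables) with `det D` real
(`det_diracMatrix_eq_ofReal_re`, `γ₅`-hermiticity).  Hence numerator and denominator of
`qcdLatticeSchwinger` are `ε` times Bochner integrals of real-valued functions; `ε ≠ 0` cancels
(`mul_div_mul_left`) and a quotient of two real integrals is real (`integral_complex_ofReal`,
`Complex.ofReal_div`) — junk branches included (a non-integrable integrand integrates to `0`,
division by `0` is `0`, both real).  Sources: Montvay–Münster 1994 §4.1 (4.17), §5.1.2 (5.16);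
Osterwalder–Seiler 1978 §2.

Pure theorem file (no definitions): the registered stub signature, proved in tree vocabulary.
-/

noncomputable section

namespace Summit.QuantumFields.QCD.Cruxes.LadderCauchyRate.Birth

open scoped BigOperators Topology
open MeasureTheory Filter
open Literature.MathematicalPhysics.AQFT Literature.Probability.LatticeModels
  Literature.MathematicalPhysics.QuantumLattice Literature.MathematicalPhysics.QuantumFieldTheory
open Summit.QuantumFields.QCD.Theses.GapBuysCauchyRate

variable {Nf : ℕ}

/-- **The smeared `glue` field is a real scalar**: `Φ_k^{glue}(f) = Σ_{x ∈ box} z_glue(k) a_k⁴ f(a_k x)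
(s_W(x) − shift_glue(k))`, with `s_W(x)` the (real) Wilson action density at `x`, is the image under
`algebraMap ℂ` of a real number. -/
private theorem smearedInsertion_glue (sch : QCDScheme Nf) (k : ℕ)
    (U : GaugeConfig 4 (sch.side k) SU3) (f : SchwartzMap (EuclideanSpace ℝ (Fin 4)) ℝ) :
    smearedInsertion sch k U QCDField.glue f = algebraMap ℂ (FermiAlg Nf (sch.side k))
      ((∑ x ∈ Literature.Probability.LatticeModels.box 4 (sch.L k),
          sch.z QCDField.glue k * sch.a k ^ 4 * f (sch.a k • siteToE x) *
            (actionDensity (fundamentalRep (Fin 3))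
                (Literature.MathematicalPhysics.QuantumLattice.configShift (-x)
                  (torusLift (sch.side k) U)) -
              sch.shift QCDField.glue k) : ℝ) : ℂ) := by
  simp only [smearedInsertion, insertion, Complex.ofReal_sum, Complex.ofReal_mul,
    Complex.ofReal_sub, map_sum, map_mul, map_sub, Algebra.smul_def]

/-- The product of two real scalars of the Grassmann algebra is the real scalar of the product. -/
private theorem algebraMap_ofReal_mul_algebraMap_ofReal {L : ℕ} [NeZero L] (a b : ℝ) :
    algebraMap ℂ (FermiAlg Nf L) (a : ℂ) * algebraMap ℂ (FermiAlg Nf L) (b : ℂ) =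
      algebraMap ℂ (FermiAlg Nf L) ((a * b : ℝ) : ℂ) := by
  rw [Complex.ofReal_mul, map_mul]

/-- **The Berezin integral of a real scalar against the Boltzmann factor is `ε` times a real
number**: `∫dψ̄dψ (c · 1) e^{−ψ̄Dψ} = ε · (c · Re det D)` (`det D` is real). -/
private theorem fermiIntegral_algebraMap_ofReal_mul_fermiBoltzmann {L : ℕ} [NeZero L]
    (U : GaugeConfig 4 L SU3) (mq : Fin Nf → ℝ) (c : ℝ) :
    fermiIntegral (algebraMap ℂ (FermiAlg Nf L) (c : ℂ) * fermiBoltzmann U mq) =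
      (-1 : ℂ) ^ (Fintype.card (FermiIdx Nf L) * (Fintype.card (FermiIdx Nf L) - 1) / 2 +
          Fintype.card (FermiIdx Nf L)) * ((c * ((diracMatrix U mq).det).re : ℝ) : ℂ) := by
  rw [← Algebra.smul_def, map_smul, smul_eq_mul, fermiIntegral_fermiBoltzmann, Complex.ofReal_mul,
    ← det_diracMatrix_eq_ofReal_re]
  ring

/-- **The fermionic partition function in a background is `ε` times a real number**:
`∫dψ̄dψ e^{−ψ̄Dψ} = ε · Re det D`. -/
private theorem fermiIntegral_fermiBoltzmann_eq_sign_mul_ofReal {L : ℕ} [NeZero L]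
    (U : GaugeConfig 4 L SU3) (mq : Fin Nf → ℝ) :
    fermiIntegral (fermiBoltzmann U mq) =
      (-1 : ℂ) ^ (Fintype.card (FermiIdx Nf L) * (Fintype.card (FermiIdx Nf L) - 1) / 2 +
          Fintype.card (FermiIdx Nf L)) * ((((diracMatrix U mq).det).re : ℝ) : ℂ) := by
  rw [fermiIntegral_fermiBoltzmann, ← det_diracMatrix_eq_ofReal_re]

/-- **A quotient of `ε`-multiples of integrals of real functions is real** (`ε ≠ 0` cancels; the
Bochner integral of a real-valued function, integrable or not, is real; `x / 0 = 0`). -/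
private theorem im_div_integral_const_mul_ofReal {α : Type*} [MeasurableSpace α] (μ : Measure α)
    {ε : ℂ} (hε : ε ≠ 0) (a b : α → ℝ) :
    ((∫ x, ε * (a x : ℂ) ∂μ) / ∫ x, ε * (b x : ℂ) ∂μ).im = 0 := by
  rw [integral_const_mul, integral_const_mul, mul_div_mul_left _ _ hε, integral_complex_ofReal,
    integral_complex_ofReal, ← Complex.ofReal_div, Complex.ofReal_im]

/-- **The bare `glue` one-point function of every scheme is real.** -/
private theorem onePoint_glue_im (sch : QCDScheme Nf) (k : ℕ)
    (f : SchwartzMap (EuclideanSpace ℝ (Fin 4)) ℝ) :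
    (sch.onePoint k QCDField.glue f).im = 0 := by
  rw [QCDScheme.onePoint_eq]
  unfold qcdLatticeSchwinger
  simp only [List.ofFn_succ, List.ofFn_zero, List.prod_cons, List.prod_nil, mul_one,
    smearedInsertion_glue, fermiIntegral_algebraMap_ofReal_mul_fermiBoltzmann,
    fermiIntegral_fermiBoltzmann_eq_sign_mul_ofReal]
  exact im_div_integral_const_mul_ofReal _ (fermiOrientationSign_ne_zero _) _ _

/-- **The bare `glue`–`glue` two-point function of every scheme is real.** -/
private theorem twoPoint_glue_im (sch : QCDScheme Nf) (k : ℕ)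
    (g f : SchwartzMap (EuclideanSpace ℝ (Fin 4)) ℝ) :
    (sch.twoPoint k QCDField.glue QCDField.glue g f).im = 0 := by
  rw [QCDScheme.twoPoint_eq]
  unfold qcdLatticeSchwinger
  simp only [List.ofFn_succ, List.ofFn_zero, List.prod_cons, List.prod_nil, mul_one,
    Matrix.cons_val_zero, Matrix.cons_val_succ, smearedInsertion_glue,
    algebraMap_ofReal_mul_algebraMap_ofReal, fermiIntegral_algebraMap_ofReal_mul_fermiBoltzmann,
    fermiIntegral_fermiBoltzmann_eq_sign_mul_ofReal]
  exact im_div_integral_const_mul_ofReal _ (fermiOrientationSign_ne_zero _) _ _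

/-- (W4) **reality of the bare `glue` one- and two-point functions** (size M, provable now: the
`glue` insertion is a real scalar, `fermiIntegral_fermiBoltzmann`, `det_diracMatrix_eq_ofReal_re`,
the orientation sign cancels, `integral_complex_ofReal`).  Registered in tree vocabulary
(= `GlueRealStmt` written out). -/
theorem stub_glueTwoPointReal :
    ∀ (Nf : ℕ) (reg : QCDRegularisation Nf) (m : Fin Nf → ℝ) (z shift : QCDField Nf → ℕ → ℝ) (k : ℕ)
      (g f : SchwartzMap (EuclideanSpace ℝ (Fin 4)) ℝ),
      ((reg.scheme m z shift).onePoint k QCDField.glue f).im = 0 ∧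
      ((reg.scheme m z shift).twoPoint k QCDField.glue QCDField.glue g f).im = 0 :=
  fun _ reg m z shift k g f =>
    ⟨onePoint_glue_im (reg.scheme m z shift) k f, twoPoint_glue_im (reg.scheme m z shift) k g f⟩

end Summit.QuantumFields.QCD.Cruxes.LadderCauchyRate.Birth

end
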